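import Mathlib.MeasureTheory.Integral.IntervalIntegral.Basic
import Mathlib.Analysis.Calculus.IteratedDeriv.Lemmas
import Mathlib.Analysis.SpecialFunctions.Pow.Real
import HarnessLib
import Summits.NavierStokesRegularity.TurbBounds.SpectralForm

/-!
# The 2-D FREE-SLIP mode functional of Whitehead–Doering (2011) and the named hypothesis `FreeSlipReduction`
(cell `pub-turb` / `turb-bounds`, v2 CANDIDATE material for the Ra-uniform free-slip row FS-U1″ of HOME/pub-turb-sos/PARAM-FS.md §10;
written by pub-turb-sos, planner-pub-turb-sos-g17-0, 2026-08-22; tree-ready variant v2g18b by planner-pub-turb-sos-g18-0 (imports `TurbBounds/SpectralForm.lean` and REUSES `SpectralForm.Profile` / `SpectralForm.sq_integral_ge_one` instead of re-declaring them — no duplicate declarations once V2-SPEC 1/3 lands). STATUS: TREE MODULE — landed as p324988 under lead decision 112 (F) (manifest FSU1-SPEC, B1′), statement-level referee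
reads gen 45 / gen 46 PASS; written to be consumed by the FS-U1″ finite part `TurbBounds/FSU1/*` + `TurbBounds/Results/FSU1.lean` (decision 114 (B)).)

HONEST FRAMING: rigorous bounds for the stated PDE and boundary conditions; no claim about physical turbulence beyond the bound.

PURPOSE. The companion of `SpectralForm.lean` (no-slip, V2SPEC) for the two-dimensional Boussinesq system between FREE-SLIP (stress-free),
isothermal, horizontal walls: it types the published background-method reduction of [Whitehead–Doering, Phys. Rev. Lett. 106 (2011) 244501,
arXiv:1104.2278, eqs. for `Nu`, `𝒬`, `𝒬_k` on p. 3] ALONE, in horizontal-Fourier mode form, as the named hypothesis `FreeSlipReduction Nu`, so that a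
row theorem `∀ Nu, FreeSlipReduction Nu → ∀ Ra ≥ 10⁶, Nu Ra ≤ (25/164)·Ra^(5/12) − 1/4` (shape `FSU1Claim` below) has exactly ONE cited hypothesis and
everything cell-made (PARAM-FS §1–§4, §10: layer profile, Young split, parity sectors, sector stiffness, regime lemmas, the exact cell table) is
kernel-checked downstream. NO Navier–Stokes / Boussinesq theory is formalised here (real analysis over Mathlib only).

THE SIGN OF THE VORTICITY–TEMPERATURE CROSS TERM (flag R-FS0 of PARAM-FS §1.2/§10.9). With `ω = ∂ₓv − ∂_y u` the printed mode functional carries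
`− Re{(a i k/Ra^{1/2}) ∫ ω̂ θ̂*}` while the energy identities printed in the same paper give the opposite sign for that `ω` (the printed sign is the
one for `Δψ = −ω`). The flag is IMMATERIAL for every use in this cell because the cross term is always removed by `|·|` + Young (as in the paper
itself). Accordingly the hypothesis is typed here in the SIGN-FREE form: the mode functional `fsModeForm` subtracts the ABSOLUTE VALUE
`(a k/√Ra)·|∫ Ω θ|`; `fsModeForm ≤` either signed functional pointwise, so `FreeSlipReduction` is IMPLIED BY the published statement with either
sign convention (`freeSlipReduction_of_signed`), i.e. it is the weaker (safer) hypothesis, and it is what PARAM-FS's chain actually establishes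
for its profiles (E_u ≥ 0 ⇒ fsModeForm ≥ 0).

REAL versus COMPLEX amplitudes. With `i k ω̂ = (D² − k²) v̂` the functional `𝒬_k` has real coefficients in `(v̂, θ̂)`, so it is non-negative on
complex pairs iff it is on real pairs (real and imaginary parts decouple); the class below is therefore stated for real `v θ : ℝ → ℝ`, with the
real vorticity amplitude `Ω := (v″ − k² v)/k` (`|ω̂| = |Ω|`).

CONTENTS:
* `vort k v` — `Ω = (v″ − k² v)/k`;
* `fsIntegrand`, `fsCross`, `fsModeForm` — `∫₀¹ [θ′² + k²θ² + (a/Ra^{3/2})(Ω′² + k²Ω²) + (b/Ra)Ω² + 2τ′ v θ] dz − (a k/√Ra)|∫₀¹ Ω θ dz|`;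
* `FreeSlipPair v θ` — the test class: `v ∈ C³(ℝ)`, `θ ∈ C¹(ℝ)`, `v = v″ = 0` (impermeable + stress-free ⇒ `ω̂ = 0`) and `θ = 0` at `z = 0, 1`;
* `SpectralConstraintFS Ra a b τ′` — `fsModeForm ≥ 0` for every `k > 0` on the class;
* `Profile τ′` — admissible background data (`τ′ ∈ L¹ ∩ L²(0,1)`, `∫₀¹ τ′ = −1`), literally the structure of `SpectralForm.Profile` (one of the two
  copies is dropped when both files are in the tree);
* `FreeSlipReduction Nu` — the NAMED HYPOTHESIS; `FreeSlipReductionSigned σ Nu` — the printed form with sign `σ = ±1`, and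
  `freeSlipReduction_of_signed : FreeSlipReductionSigned σ Nu → FreeSlipReduction Nu`;
* guards: `freeSlipPair_zero`, `sq_integral_ge_one`, `freeSlipReduction_conduction : FreeSlipReduction (fun _ => 1)` (satisfiable as typed);
* `FSU1Claim Nu` — the SHAPE of the candidate row FS-U1″ (a `Prop`, not asserted): `∀ Ra ≥ 10⁶, Nu Ra ≤ (25/164)·Ra^(5/12) − 1/4`.
-/

set_option linter.style.longLine false

noncomputable section

namespace Summit.NavierStokesRegularity.TurbBounds.SpectralFormFreeSlip

open SpectralForm (Profile sq_integral_ge_one)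

open MeasureTheory intervalIntegral Set

/-! ## 1. The free-slip mode functional (Whitehead–Doering 2011, p. 3; PARAM-FS §1.2–§1.3) -/

/-- Real vorticity amplitude of a velocity mode: `Ω(z) = (v″(z) − k² v(z))/k` (from `i k ω̂ = D² v̂ − k² v̂`; `|ω̂| = |Ω|`). -/
def vort (k : ℝ) (v : ℝ → ℝ) (z : ℝ) : ℝ := (deriv (deriv v) z - k ^ 2 * v z) / k

/-- Integrand of the sign-free part of the free-slip mode functional at height `z`:
`θ′² + k²θ² + (a/Ra^{3/2})(Ω′² + k²Ω²) + (b/Ra)Ω² + 2 τ′ v θ` with `Ω = vort k v` (here `a/Ra^{3/2}` is written `a/(Ra·√Ra)`). -/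
def fsIntegrand (Ra a b : ℝ) (τp : ℝ → ℝ) (k : ℝ) (v θ : ℝ → ℝ) (z : ℝ) : ℝ :=
  (deriv θ z) ^ 2 + k ^ 2 * (θ z) ^ 2
    + a / (Ra * Real.sqrt Ra) * ((deriv (vort k v) z) ^ 2 + k ^ 2 * (vort k v z) ^ 2)
    + b / Ra * (vort k v z) ^ 2 + 2 * τp z * v z * θ z

/-- The vorticity–temperature cross term in absolute value: `(a k/√Ra)·|∫₀¹ Ω θ dz|`. -/
def fsCross (Ra a k : ℝ) (v θ : ℝ → ℝ) : ℝ :=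
  a * k / Real.sqrt Ra * |∫ z in (0 : ℝ)..1, vort k v z * θ z|

/-- The SIGN-FREE free-slip mode functional `𝒬ᵃᵇˢ_k[v, θ] = ∫₀¹ fsIntegrand dz − (a k/√Ra)|∫₀¹ Ω θ dz|`; it is `≤` the printed functional
for either sign convention of the cross term (`fsModeForm_le_signed`). -/
def fsModeForm (Ra a b : ℝ) (τp : ℝ → ℝ) (k : ℝ) (v θ : ℝ → ℝ) : ℝ :=
  (∫ z in (0 : ℝ)..1, fsIntegrand Ra a b τp k v θ z) - fsCross Ra a k v θ

/-- The printed (signed) free-slip mode functional with sign convention `σ` for the cross term: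
`∫₀¹ fsIntegrand dz + σ (a k/√Ra) ∫₀¹ Ω θ dz` (`σ = −1` as printed for `ω = ∂ₓv − ∂_y u`; `σ = +1` from the printed energy identities; flag R-FS0). -/
def fsModeFormSigned (σ Ra a b : ℝ) (τp : ℝ → ℝ) (k : ℝ) (v θ : ℝ → ℝ) : ℝ :=
  (∫ z in (0 : ℝ)..1, fsIntegrand Ra a b τp k v θ z) + σ * (a * k / Real.sqrt Ra * ∫ z in (0 : ℝ)..1, vort k v z * θ z)

/-- The free-slip test class of the gap (stress-free, impermeable, isothermal walls at `z = 0` and `z = 1`): `v ∈ C³(ℝ)` (so that `Ω′` is a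
function), `θ ∈ C¹(ℝ)`, `v(0) = v(1) = 0` (impermeable), `v″(0) = v″(1) = 0` (stress-free: `ω̂ = 0` at the walls given `v = 0`), `θ(0) = θ(1) = 0`.
(The cited statement is on the Sobolev closure of this class; restrictions of such functions are dense there and the functional is continuous in
that topology — the same density remark as in `SpectralForm.TwoSided`.) -/
structure FreeSlipPair (v θ : ℝ → ℝ) : Prop where
  /-- `v` is three times continuously differentiable. -/
  hv : ContDiff ℝ 3 v
  /-- `θ` is continuously differentiable. -/
  hθ : ContDiff ℝ 1 θ
  /-- impermeable bottom wall: `v(0) = 0`. -/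
  v_bot : v 0 = 0
  /-- impermeable top wall: `v(1) = 0`. -/
  v_top : v 1 = 0
  /-- stress-free bottom wall: `v″(0) = 0`. -/
  ddv_bot : deriv (deriv v) 0 = 0
  /-- stress-free top wall: `v″(1) = 0`. -/
  ddv_top : deriv (deriv v) 1 = 0
  /-- isothermal bottom wall: `θ(0) = 0`. -/
  θ_bot : θ 0 = 0
  /-- isothermal top wall: `θ(1) = 0`. -/
  θ_top : θ 1 = 0

/-- The free-slip spectral constraint at `(Ra, a, b, τ′)`: `fsModeForm ≥ 0` for every horizontal wavenumber `k > 0` and every free-slip pair. -/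
def SpectralConstraintFS (Ra a b : ℝ) (τp : ℝ → ℝ) : Prop :=
  ∀ k : ℝ, 0 < k → ∀ v θ : ℝ → ℝ, FreeSlipPair v θ → 0 ≤ fsModeForm Ra a b τp k v θ

/-- The signed variant of the constraint (sign convention `σ`). -/
def SpectralConstraintFSSigned (σ Ra a b : ℝ) (τp : ℝ → ℝ) : Prop :=
  ∀ k : ℝ, 0 < k → ∀ v θ : ℝ → ℝ, FreeSlipPair v θ → 0 ≤ fsModeFormSigned σ Ra a b τp k v θ

/- `Profile` = `SpectralForm.Profile` (tree file `TurbBounds/SpectralForm.lean`, V2-SPEC 1/3): admissible background data, reused — not re-declared. -/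

/-! ## 2. The named hypothesis = the cited free-slip reduction (USED as a hypothesis, never proved in this cell) -/

/-- **Named hypothesis `FreeSlipReduction Nu`** (harness model). TRANSCRIPTION: for every `Ra > 0`, every `a > 0`, every `0 < b < 1` and every
admissible `τ′` (`Profile τ′`), IF `SpectralConstraintFS Ra a b τ′` holds (`fsModeForm ≥ 0` for all `k > 0` on the free-slip class) THEN
`Nu(Ra) ≤ (∫₀¹ τ′² − b)/(1 − b)`.
CONTENT = the published reduction of Whitehead–Doering (2011), p. 3: `Nu = (∫τ′² − b)/(1−b) − 𝒬/(1−b)` with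
`𝒬 = ⟨|∇θ|² + (a/Ra^{3/2})|∇ω|² + (b/Ra)ω² + 2τ′vθ ± (a/Ra^{1/2})ω∂ₓθ⟩`, 'hence if 𝒬 ≥ 0 for all relevant θ, ω, v the first term bounds Nu',
and 'positivity of 𝒬 is equivalent to positivity of 𝒬_k for each horizontal wavenumber k' (horizontal Fourier transform; `k = 0` carries no
constraint), for the 2-D Boussinesq system in a horizontally periodic layer (any period) between free-slip isothermal walls, any Prandtl number
`Pr ∈ (0, ∞]`; in the sign-free form explained in the module docstring (weaker than either printed sign convention: `freeSlipReduction_of_signed`).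
MEANING OF `Nu`: any function such that `Nu Ra` is the (long-time averaged) Nusselt number of some admissible solution at Rayleigh number `Ra`;
the cited theorem bounds every such value. VACUITY: satisfiable as typed (`freeSlipReduction_conduction`). -/
def FreeSlipReduction (Nu : ℝ → ℝ) : Prop :=
  ∀ (Ra a b : ℝ) (τp : ℝ → ℝ), 0 < Ra → 0 < a → 0 < b → b < 1 → Profile τp → SpectralConstraintFS Ra a b τp →
    Nu Ra ≤ ((∫ z in (0 : ℝ)..1, τp z ^ 2) - b) / (1 - b)

/-- The printed form of the hypothesis with sign convention `σ` for the cross term. -/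
def FreeSlipReductionSigned (σ : ℝ) (Nu : ℝ → ℝ) : Prop :=
  ∀ (Ra a b : ℝ) (τp : ℝ → ℝ), 0 < Ra → 0 < a → 0 < b → b < 1 → Profile τp → SpectralConstraintFSSigned σ Ra a b τp →
    Nu Ra ≤ ((∫ z in (0 : ℝ)..1, τp z ^ 2) - b) / (1 - b)

/-! ## 3. Elementary facts and vacuity guards -/

/-- The sign-free functional is below the signed one for `σ = ±1` (`−c|I| ≤ σ c I` for `c ≥ 0`). -/
theorem fsModeForm_le_signed {σ Ra a k b : ℝ} {τp v θ : ℝ → ℝ} (hσ : σ = 1 ∨ σ = -1) (ha : 0 ≤ a) (hk : 0 ≤ k) :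
    fsModeForm Ra a b τp k v θ ≤ fsModeFormSigned σ Ra a b τp k v θ := by
  unfold fsModeForm fsModeFormSigned fsCross
  set I := ∫ z in (0 : ℝ)..1, vort k v z * θ z
  have hc : 0 ≤ a * k / Real.sqrt Ra := div_nonneg (mul_nonneg ha hk) (Real.sqrt_nonneg _)
  have h1 : -(a * k / Real.sqrt Ra * |I|) ≤ σ * (a * k / Real.sqrt Ra * I) := by
    rcases hσ with rfl | rfl
    · have := mul_le_mul_of_nonneg_left (neg_abs_le I) hc
      linarith
    · have := mul_le_mul_of_nonneg_left (le_abs_self I) hc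
      linarith
  linarith

/-- Either printed sign convention of the cited reduction implies the sign-free hypothesis used by this cell. -/
theorem freeSlipReduction_of_signed {σ : ℝ} (hσ : σ = 1 ∨ σ = -1) {Nu : ℝ → ℝ} (h : FreeSlipReductionSigned σ Nu) :
    FreeSlipReduction Nu := by
  intro Ra a b τp hRa ha hb hb1 hprof hcon
  refine h Ra a b τp hRa ha hb hb1 hprof ?_
  intro k hk v θ hpair
  exact le_trans (hcon k hk v θ hpair) (fsModeForm_le_signed hσ ha.le hk.le)

/-- The free-slip class is inhabited (by the zero pair). -/
theorem freeSlipPair_zero : FreeSlipPair (fun _ => 0) (fun _ => 0) where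
  hv := contDiff_const
  hθ := contDiff_const
  v_bot := rfl
  v_top := rfl
  ddv_bot := by simp
  ddv_top := by simp
  θ_bot := rfl
  θ_top := rfl

/-- VACUITY GUARD: the hypothesis is satisfiable as typed — the conduction value `Nu ≡ 1` satisfies it, because every instance of the bound
`(∫τ′² − b)/(1 − b)` is `≥ 1`. -/
theorem freeSlipReduction_conduction : FreeSlipReduction (fun _ => 1) := by
  intro Ra a b τp _ _ _ hb1 hprof _
  have h1 : 1 ≤ ∫ z in (0 : ℝ)..1, τp z ^ 2 := sq_integral_ge_one hprof
  exact (one_le_div (by linarith)).mpr (by linarith)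

/-! ## 4. The shape of the candidate row FS-U1″ (PARAM-FS §10.8) — a `Prop`, NOT asserted here -/

/-- SHAPE of the candidate Ra-uniform free-slip row FS-U1″ (PARAM-FS.md §10.8; exact-checked chain, NOT yet a certificate of record, NOT proved
here): `∀ Ra ≥ 10⁶, Nu Ra ≤ (25/164)·Ra^(5/12) − 1/4`. The row theorem, when licensed and built, reads `∀ Nu, FreeSlipReduction Nu → FSU1Claim Nu`. -/
def FSU1Claim (Nu : ℝ → ℝ) : Prop :=
  ∀ Ra : ℝ, (10 : ℝ) ^ 6 ≤ Ra → Nu Ra ≤ 25 / 164 * Ra ^ ((5 : ℝ) / 12) - 1 / 4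


/-! ## 5. (gen 18, 2026-08-22) The INFINITE-PRANDTL-NUMBER reading in two AND three dimensions, and the mode-wise balance parameter

At `Pr = ∞` the momentum equation is the Stokes system `−Δu + ∇p = Ra T e₃`, `∇·u = 0` [Seis 2025, arXiv:2504.11051, eqs. (1)–(3);
free-slip `w = ∂_z u_H = 0`], in two OR three space dimensions, horizontally periodic with any periods. Then (PARAM-FS.md §11.2, derivation
written out there; Whitehead–Doering, J. Fluid Mech. 707 (2012) 241–259 = acq-10068, transcribed from [Nobili 2023, arXiv:2112.15564,
p. 17] and [Arslan–Fantuzzi–Craske–Wynn 2025, arXiv:2403.14407, §5 Lemma 2]):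
* the velocity is slaved to the temperature mode by mode: with the pseudo-vorticity `k ζ̂ := ŵ″ − k² ŵ` one has `ζ̂″ − k² ζ̂ = Ra k θ̂` and
  `ζ̂ = ŵ = ŵ″ = 0` at `z = 0, 1` for every horizontal wavenumber `k > 0`;
* hence the 'pseudo-enstrophy' identity `‖ζ̂′‖² + k²‖ζ̂‖² + Ra k Re ∫ θ̂ ζ̂* = 0` and the energy identity `‖ζ̂‖² = Ra Re ∫ ŵ θ̂*` hold FOR
  EACH `k` SEPARATELY (not only summed over `k` and time-averaged as the 2-D enstrophy balance at finite `Pr`), and the horizontal mean of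
  `|∇u|²` is `Σ_k ‖ζ̂_k‖²` (the toroidal component vanishes for Stokes flow between stress-free walls; PARAM-FS §11.2 (v));
* consequently the real one-wavenumber functional is LITERALLY `fsModeForm Ra a b τ′ k v θ` of §1 with `Ω = vort k v = ζ̂`-amplitude, and the
  background-method reduction reads exactly as `FreeSlipReduction`, now for the Nusselt numbers of 2-D or 3-D solutions at `Pr = ∞` —
  with the ADDITIONAL freedom that the weight `a` of the pseudo-enstrophy identity may depend on the wavenumber: `a = a(k)`.

So: (i) `FreeSlipReductionInfPr Nu` below is the SAME predicate as `FreeSlipReduction Nu`; only the MEANING of `Nu` (which solutions' Nusselt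
numbers it ranges over) and the citation differ — a row theorem `∀ Nu, FreeSlipReduction Nu → FSU1Claim Nu` therefore serves BOTH settings
(2-D any `Pr`: WD11; 2-D/3-D `Pr = ∞`: WD12) with no change to its finite part (PARAM-FS §11.3: candidate FS-U1″-∞, `C = 25/164` versus the
printed 3-D `Pr = ∞` constants `0.2982` / `0.28764`); (ii) `FreeSlipReductionModewise Nu` is the natural (formally stronger) `Pr = ∞`
statement with `a : ℝ → ℝ`; it implies `FreeSlipReduction` (`freeSlipReduction_of_modewise`, constant weight), and PARAM-FS §11.4 records
that the extra freedom buys NOTHING at leading order for the cell's profile class (the min–max over `(κ, a)` is a saddle at WD11's `(κ*, a)`),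
so no row uses it; it is typed here only so that the examined lever has a name. STATUS as §§1–4 (tree module); no row consumes §5. -/

/-- The free-slip spectral constraint with a WAVENUMBER-DEPENDENT pseudo-enstrophy weight `a : ℝ → ℝ` (legitimate at `Pr = ∞`, where the
identity `‖ζ̂′‖² + k²‖ζ̂‖² + Ra k Re∫θ̂ζ̂* = 0` holds for each `k` separately): `fsModeForm Ra (a k) b τ′ k v θ ≥ 0` for every `k > 0` on the class. -/
def SpectralConstraintFSModewise (Ra : ℝ) (a : ℝ → ℝ) (b : ℝ) (τp : ℝ → ℝ) : Prop :=
  ∀ k : ℝ, 0 < k → ∀ v θ : ℝ → ℝ, FreeSlipPair v θ → 0 ≤ fsModeForm Ra (a k) b τp k v θ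

/-- **Named hypothesis `FreeSlipReductionInfPr Nu`** — the `Pr = ∞` reading (two or three space dimensions) of `FreeSlipReduction`:
DEFINITIONALLY THE SAME predicate (`freeSlipReductionInfPr_iff`). TRANSCRIPTION: for the Boussinesq–Stokes system `∂ₜT + u·∇T = ΔT`,
`∇·u = 0`, `−Δu + ∇p = Ra T e₃` in a horizontally periodic layer (any periods, `d = 2` or `3`) between free-slip isothermal walls, for every
`Ra > 0`, `a > 0`, `0 < b < 1` and admissible `τ′`: IF `fsModeForm Ra a b τ′ k ≥ 0` on the free-slip class for all `k > 0` (`Ω` = the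
pseudo-vorticity amplitude `(v″ − k²v)/k`) THEN `limsup Nu ≤ (∫₀¹ τ′² − b)/(1 − b)`. SOURCES: Whitehead–Doering 2012 (J. Fluid Mech. 707,
241–259; paywalled, acq-10068) as transcribed by Nobili 2023 [arXiv:2112.15564 p. 17: 'the argument is almost identical to the one for the
2-D theorem, with the pointwise velocity estimate replaced by its pseudo-vorticity version'] and Arslan–Fantuzzi–Craske–Wynn 2025
[arXiv:2403.14407 §5, Lemma 2 'pseudo-vorticity and integral estimates [Whitehead 2012]']; cell derivation PARAM-FS.md §11.2.
MEANING OF `Nu`: `Nu Ra` = the long-time-averaged Nusselt number of some such solution at Rayleigh number `Ra`. -/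
def FreeSlipReductionInfPr (Nu : ℝ → ℝ) : Prop := FreeSlipReduction Nu

/-- The two readings are one predicate. -/
theorem freeSlipReductionInfPr_iff (Nu : ℝ → ℝ) : FreeSlipReductionInfPr Nu ↔ FreeSlipReduction Nu := Iff.rfl

/-- **`FreeSlipReductionModewise Nu`** — the formally stronger `Pr = ∞` reduction with a wavenumber-dependent weight `a : ℝ → ℝ`
(`a k > 0` for `k > 0`): IF `SpectralConstraintFSModewise Ra a b τ′` THEN `Nu Ra ≤ (∫₀¹ τ′² − b)/(1 − b)`. (PARAM-FS §11.2 (vi)–(vii):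
at `Pr = ∞` the weight multiplies an identity that holds mode by mode.) Not used by any candidate row (§11.4: no leading-order gain). -/
def FreeSlipReductionModewise (Nu : ℝ → ℝ) : Prop :=
  ∀ (Ra b : ℝ) (a : ℝ → ℝ) (τp : ℝ → ℝ), 0 < Ra → (∀ k : ℝ, 0 < k → 0 < a k) → 0 < b → b < 1 → Profile τp →
    SpectralConstraintFSModewise Ra a b τp → Nu Ra ≤ ((∫ z in (0 : ℝ)..1, τp z ^ 2) - b) / (1 - b)

/-- A constant weight is a special mode-wise weight: the mode-wise reduction implies the one the cell's rows use. -/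
theorem freeSlipReduction_of_modewise {Nu : ℝ → ℝ} (h : FreeSlipReductionModewise Nu) : FreeSlipReduction Nu := by
  intro Ra a b τp hRa ha hb hb1 hprof hcon
  exact h Ra b (fun _ => a) τp hRa (fun _ _ => ha) hb hb1 hprof (fun k hk v θ hp => hcon k hk v θ hp)

/-- VACUITY GUARD for the mode-wise hypothesis: satisfiable as typed (conduction value `Nu ≡ 1`). -/
theorem freeSlipReductionModewise_conduction : FreeSlipReductionModewise (fun _ => 1) := by
  intro Ra b a τp _ _ _ hb1 hprof _
  have h1 : 1 ≤ ∫ z in (0 : ℝ)..1, τp z ^ 2 := sq_integral_ge_one hprof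
  exact (one_le_div (by linarith)).mpr (by linarith)

/-- The `Pr = ∞` (2-D / 3-D) candidate row FS-U1″-∞ has the SAME shape and the SAME hypothesis predicate as FS-U1″:
`∀ Nu, FreeSlipReductionInfPr Nu → FSU1Claim Nu` is literally `∀ Nu, FreeSlipReduction Nu → FSU1Claim Nu`. -/
theorem fsu1_infPr_same_statement :
    (∀ Nu, FreeSlipReductionInfPr Nu → FSU1Claim Nu) ↔ (∀ Nu, FreeSlipReduction Nu → FSU1Claim Nu) := Iff.rfl

end Summit.NavierStokesRegularity.TurbBounds.SpectralFormFreeSlip
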